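import Mathlib.GroupTheory.GroupAction.Basic
import Mathlib.GroupTheory.Perm.Basic
import Mathlib.Data.ZMod.Basic
import Mathlib.Data.Fintype.Perm
import Mathlib.Data.Fintype.Inv
import Mathlib.Order.Hom.Set
import Mathlib.Order.Fin.Basic
import Mathlib.Algebra.BigOperators.Group.Finset.Basic
import Mathlib.Algebra.Order.Field.Rat
import Mathlib.Tactic.FieldSimp
import HarnessLib

/-!
# [IUTchII] Remarks 3.5.2, 4.7.3, 4.7.4: the combinatorial models of conjugate
# synchronization and of the uniradiality/multiradiality of the `F_l^⋊±`- and `F_l^⋇`-symmetries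

S. Mochizuki, *Inter-universal Teichmüller theory II*, Remark 3.5.2 (i)–(v) (kurims Dec-2020
manuscript pp. 96–99), Remark 4.7.3 (i)–(iii) (pp. 143–145), Remark 4.7.4 (i)–(iii)
(pp. 145–147), with Remarks 3.5.3, 4.7.2, 4.7.5, 4.7.6 [cite: Mochizuki2012, Rmk 3.5.2 p.96].
Claim key DISPUTED (D-0012). These Remarks contain small, fully finite combinatorial assertions,
which are PROVED here as stated; the surrounding interpretive prose ("may be thought of as …")
is quoted in docstrings and not typed.

**What is printed and proved.**
* Rmk 3.5.2 (i) p. 96–97: `E = {0,1}` with `0 < 1`; `S` its underlying set, "`Aut(S) ≅ ℤ/2ℤ`";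
  to synchronize the indeterminacies `s ↦ 0_Q?, 1_Q?` "amounts, tautologically, to the requirement
  of an automorphism of `≺_Q` that induces the unique nontrivial automorphism of the set
  `E_Q = {0_Q, 1_Q}`. On the other hand, by the definition of an inequality, it is a tautology that
  such an automorphism of `≺_Q` cannot exist"; the indeterminacies "give rise to a total of 4
  possibilities … certain of which [i.e., `0_S, 1_S ↦ 0_Q` and `0_S, 1_S ↦ 1_Q`] fail to be
  bijective" (`card_perm_fin_two`, `orderIso_fin_two_eq_refl`, `card_assignments`,
  `card_bijective_assignments`, `const_not_bijective`).
* Rmk 4.7.3 (iii) p. 145: "it is natural to think of the volumes computed at each `j ∈ F_l^⋇` as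
  being assigned a weight `1/l⋇` — i.e., so that the diagonal embedding of the constant
  distribution is compatible with taking the constant distribution to be of weight 1"
  (`sum_weights_eq_one`).
* Rmk 4.7.4 (iii) p. 147 (the formulation "in terms of the formalism of uniradial and multiradial
  environments"): for two spokes `α, β` the set of arrows `(F_l)_α → (F_l)_β` "consist[s] of
  precisely one element if the actions `(F_l^⋊±)_γ ↷ (F_l)_γ` … for `γ = α, β`, determine an action
  of `(F_l^⋊±)_α × (F_l^⋊±)_β` on the co-product `(F_l)_α ∐_0 (F_l)_β` obtained by identifying the
  respective zero labels `0_α, 0_β`, and to equal the empty set if such an action does not exist"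
  (resp. with `F_l^⋇ ↷ |F_l|`); "the resulting radial environment is easily seen to be uniradial
  (respectively, multiradial). We leave the routine details to the reader." PROVED in the abstract
  form that decides it: if a group action moves the glue point, NO compatible product action on
  the glued coproduct exists (`GluedPair.no_productAction_of_moves`) — so for `F_l^⋊± ↷ F_l`,
  which contains the translation `x ↦ x+1` (`zmod_translation_moves_zero`), the arrow sets are
  EMPTY (4.7.4 (ii)(a): the actions "fail to commute"); if both actions FIX the glue point, the
  evident product action exists (`GluedPair.productAction`), as for `F_l^⋇ ↷ |F_l|`, induced by
  units acting by multiplication, which fix `0` (`units_smul_zero`) (4.7.4 (ii)(b): the actions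
  "commute").

Dictionary: `F_l = ZMod l`; the glued coproduct `X_α ∐_{x₀} X_β` is
`Option ({x // x ≠ x₀} ⊕ {x // x ≠ x₀})` with `none` the identified point. Owners of `F_l^⋊±`,
`F_l^⋇`, `|F_l|` as named objects: abc-iut-L5-t1/L5-t4 ([IUTchI] §0, Def 6.1) — TODO-merge; the
theorems below are stated for ANY action that moves (resp. fixes) the glue point, which is the
property of `F_l^⋊±` (resp. `F_l^⋇`) the Remark uses. Not typed (expository prose, no
mathematical assertion): Rmk 3.5.2 (ii)–(v), 3.5.3, 4.7.2, 4.7.3 (i)–(ii), 4.7.4 (i), 4.7.5,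
4.7.6 — their one mathematical kernel (which symmetry moves the zero label) is exactly
`zmod_translation_moves_zero` / `units_smul_zero`.
-/

namespace Literature.IUT.HodgeArakelov

open scoped BigOperators

universe u v

/-! ### 1. Remark 3.5.2 (i): the two-element combinatorial model (pp. 96–97) -/

namespace TwoPointModel

/-- "`Aut(S) ≅ ℤ/2ℤ`" for the two-element set `S` underlying `E = {0,1}` ([IUTchII] Rmk 3.5.2 (i)
p. 96): `Aut(S)` has exactly two elements. [cite: Mochizuki2012, Rmk 3.5.2 (i) p.96] -/
theorem card_perm_fin_two : Fintype.card (Equiv.Perm (Fin 2)) = 2 := by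
  rw [Fintype.card_perm, Fintype.card_fin]; rfl

/-- "by the definition of an inequality, it is a tautology that such an automorphism of `≺_Q`
[inducing the nontrivial automorphism of `E_Q = {0_Q,1_Q}`] cannot exist" ([IUTchII] Rmk 3.5.2
(i) p. 97): the ordered set `0 < 1` has no order-automorphism other than the identity.
[cite: Mochizuki2012, Rmk 3.5.2 (i) p.97] -/
theorem orderIso_fin_two_eq_refl (f : Fin 2 ≃o Fin 2) : f = OrderIso.refl (Fin 2) :=
  Subsingleton.elim _ _

/-- In particular no order-automorphism of `0 < 1` swaps `0` and `1` ([IUTchII] Rmk 3.5.2 (i)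
p. 97). [cite: Mochizuki2012, Rmk 3.5.2 (i) p.97] -/
theorem no_orderIso_swaps (f : Fin 2 ≃o Fin 2) : f 0 ≠ 1 := by
  rw [orderIso_fin_two_eq_refl f]; decide

/-- "these indeterminacies give rise to a total of 4 possibilities `0_S ↦ 0_Q?, 1_Q?`,
`1_S ↦ 0_Q?, 1_Q?` for the desired assignment" ([IUTchII] Rmk 3.5.2 (i) p. 97).
[cite: Mochizuki2012, Rmk 3.5.2 (i) p.97] -/
theorem card_assignments : Fintype.card (Fin 2 → Fin 2) = 4 := by
  simp

/-- "… certain of which [i.e., `0_S, 1_S ↦ 0_Q` and `0_S, 1_S ↦ 1_Q`] fail to be bijective": the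
constant assignments are not bijective ([IUTchII] Rmk 3.5.2 (i) p. 97).
[cite: Mochizuki2012, Rmk 3.5.2 (i) p.97] -/
theorem const_not_bijective (c : Fin 2) : ¬ Function.Bijective (fun _ : Fin 2 => c) := by
  intro h
  have := h.1 (a₁ := 0) (a₂ := 1) rfl
  exact absurd this (by decide)

/-- … and exactly the two permutations are bijective: `4 = 2 + 2` ([IUTchII] Rmk 3.5.2 (i) p. 97).
[cite: Mochizuki2012, Rmk 3.5.2 (i) p.97] -/
theorem card_bijective_assignments :
    Fintype.card {f : Fin 2 → Fin 2 // Function.Bijective f} = 2 := by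
  rw [Fintype.card_congr (bijSubtypeEquivPerm (Fin 2))]
  exact card_perm_fin_two
where
  /-- bijective self-maps of a finite type are its permutations -/
  bijSubtypeEquivPerm (α : Type) [Fintype α] [DecidableEq α] :
      {f : α → α // Function.Bijective f} ≃ Equiv.Perm α :=
    { toFun := fun f => ⟨f.1, Fintype.bijInv f.2, Fintype.leftInverse_bijInv f.2,
        Fintype.rightInverse_bijInv f.2⟩
      invFun := fun e => ⟨e, e.bijective⟩
      left_inv := fun f => by ext; rfl
      right_inv := fun e => by ext; rfl }

end TwoPointModel

/-- Remark 3.5.2 (ii) p. 98, the "central principle", as a record of its three named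
requirements (a)–(c) (Prop slots over the §2–§3 vocabulary; quoted, not asserted): "the
`F_l^⋊±`-symmetry … allows one to construct (a) symmetrizing isomorphisms … compatible with
maintaining a (b) bijective link with the set of labels `LabCusp^±(Π_X(M^Θ_*))` … all relative to
(c) a single basepoint". -- TODO-merge: abc-iut-L6-t1 (Remark 2.6.1/2.6.2 vocabulary).
[cite: Mochizuki2012, Rmk 3.5.2 (ii) p.98] -/
structure ConjugateSynchronizationPrinciple where
  /-- (a) symmetrizing isomorphisms -/
  symmetrizingIsos : Prop
  /-- (b) bijective link with the set of labels -/
  bijectiveLabelLink : Prop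
  /-- (c) a single basepoint -/
  singleBasepoint : Prop

/-! ### 2. Remark 4.7.3 (iii): weights `1/l⋇` (p. 145) -/

/-- [IUTchII] Rmk 4.7.3 (iii) p. 145: assigning each `j ∈ F_l^⋇` the weight `1/l⋇` makes "the
diagonal embedding of the constant distribution … compatible with taking the constant
distribution to be of weight 1": `∑_{j ∈ F_l^⋇} 1/l⋇ = 1` (`l⋇ ≥ 1`).
[cite: Mochizuki2012, Rmk 4.7.3 (iii) p.145] -/
theorem sum_weights_eq_one (lstar : ℕ) (hl : 0 < lstar) :
    ∑ _j : Fin lstar, (1 / lstar : ℚ) = 1 := by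
  rw [Finset.sum_const, Finset.card_univ, Fintype.card_fin, nsmul_eq_mul]
  have : (lstar : ℚ) ≠ 0 := by exact_mod_cast hl.ne'
  field_simp

/-! ### 3. Remark 4.7.4 (iii): product actions on two spokes glued at the zero label (p. 147) -/

/-- The co-product `X_α ∐_{x₀} X_β` of two copies of `X` "obtained by identifying the respective
zero labels `0_α, 0_β`" ([IUTchII] Rmk 4.7.4 (iii) p. 147): `none` is the identified point, `inl`/`inr`
the remaining points of the spokes `α`/`β`. [cite: Mochizuki2012, Rmk 4.7.4 (iii) p.147] -/
abbrev GluedPair (X : Type u) (x₀ : X) : Type u := Option ({x : X // x ≠ x₀} ⊕ {x : X // x ≠ x₀})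

namespace GluedPair

variable {X : Type u} {x₀ : X} [DecidableEq X]

/-- The spoke `α`: `X_α ↪ X_α ∐_{x₀} X_β`. [cite: Mochizuki2012, Rmk 4.7.4 (iii) p.147] -/
def inA (x : X) : GluedPair X x₀ := if h : x = x₀ then none else some (Sum.inl ⟨x, h⟩)

/-- The spoke `β`: `X_β ↪ X_α ∐_{x₀} X_β`. [cite: Mochizuki2012, Rmk 4.7.4 (iii) p.147] -/
def inB (x : X) : GluedPair X x₀ := if h : x = x₀ then none else some (Sum.inr ⟨x, h⟩)

omit [DecidableEq X] in
/-- "determine an action of `G_α × G_β` on the co-product": an action of `G × G` on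
`X_α ∐_{x₀} X_β` restricting to the given action of `G` on each spoke ([IUTchII] Rmk 4.7.4 (iii)
p. 147). [cite: Mochizuki2012, Rmk 4.7.4 (iii) p.147] -/
structure IsProductAction (G : Type v) [Group G] [MulAction G X] [DecidableEq X]
    (act : MulAction (G × G) (GluedPair X x₀)) : Prop where
  /-- `(g,1)` acts on the spoke `α` through `g` -/
  left : ∀ (g : G) (x : X),
    (letI := act; ((g, (1 : G)) : G × G) • (inA x : GluedPair X x₀)) = inA (g • x)
  /-- `(1,h)` acts on the spoke `β` through `h` -/
  right : ∀ (h : G) (x : X),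
    (letI := act; (((1 : G), h) : G × G) • (inB x : GluedPair X x₀)) = inB (h • x)

omit [DecidableEq X] in
/-- `inA x = none ↔ x = x₀`. [cite: Mochizuki2012, Rmk 4.7.4 (iii) p.147] -/
theorem inA_eq_none_iff [DecidableEq X] (x : X) : (inA x : GluedPair X x₀) = none ↔ x = x₀ := by
  unfold inA; split_ifs with h <;> simp [h]

omit [DecidableEq X] in
/-- `inB x = none ↔ x = x₀`. [cite: Mochizuki2012, Rmk 4.7.4 (iii) p.147] -/
theorem inB_eq_none_iff [DecidableEq X] (x : X) : (inB x : GluedPair X x₀) = none ↔ x = x₀ := by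
  unfold inB; split_ifs with h <;> simp [h]

/-- **Remark 4.7.4 (ii)(a)/(iii), uniradial case, proved:** if some `g ∈ G` MOVES the glue point
(`g • x₀ ≠ x₀`, as the translation `x ↦ x + 1` of `F_l^⋊± ↷ F_l` moves `0`), then there is NO
action of `G × G` on `X_α ∐_{x₀} X_β` restricting to the given actions on the two spokes — "the
`F_l^⋊±`-actions on distinct spokes fail to commute with one another" (p. 146), the arrow sets of
(iii) are empty, the environment is uniradial. [cite: Mochizuki2012, Rmk 4.7.4 (iii) p.147] -/
theorem no_productAction_of_moves {G : Type v} [Group G] [MulAction G X] (g : G)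
    (hg : g • x₀ ≠ x₀) (act : MulAction (G × G) (GluedPair X x₀)) : ¬ IsProductAction G act := by
  intro hP
  letI := act
  -- `(g,1)` preserves the set `range inA`, hence its complement `{some (inr _)}`
  have hA : ∀ z : GluedPair X x₀, (∃ y, z = some (Sum.inr y)) →
      ∃ y', ((g, (1 : G)) : G × G) • z = some (Sum.inr y') := by
    rintro z ⟨y, rfl⟩
    -- the image is not in the range of `inA`, since `(g,1)` is injective and `range inA` is stable
    rcases h : ((g, (1 : G)) : G × G) • (some (Sum.inr y) : GluedPair X x₀) with _ | ⟨⟨x, hx⟩ | y'⟩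
    · -- image `none = inA x₀ = (g,1) • inA (g⁻¹ • x₀)`
      have h1 : ((g, (1 : G)) : G × G) • (inA (g⁻¹ • x₀) : GluedPair X x₀) = none := by
        rw [hP.left, smul_inv_smul]; exact (inA_eq_none_iff x₀).mpr rfl
      have := smul_left_cancel _ (h.trans h1.symm)
      have hne : (inA (g⁻¹ • x₀) : GluedPair X x₀) ≠ some (Sum.inr y) := by
        unfold inA; split_ifs <;> simp
      exact absurd this.symm hne
    · have h1 : ((g, (1 : G)) : G × G) • (inA (g⁻¹ • x) : GluedPair X x₀) = some (Sum.inl ⟨x, hx⟩) := by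
        rw [hP.left, smul_inv_smul]; unfold inA; rw [dif_neg hx]
      have := smul_left_cancel _ (h.trans h1.symm)
      have hne : (inA (g⁻¹ • x) : GluedPair X x₀) ≠ some (Sum.inr y) := by
        unfold inA; split_ifs <;> simp
      exact absurd this.symm hne
    · exact ⟨y', rfl⟩
  have hB : ∀ z : GluedPair X x₀, (∃ y, z = some (Sum.inl y)) →
      ∃ y', (((1 : G), g) : G × G) • z = some (Sum.inl y') := by
    rintro z ⟨y, rfl⟩
    rcases h : (((1 : G), g) : G × G) • (some (Sum.inl y) : GluedPair X x₀) with _ | ⟨y' | ⟨x, hx⟩⟩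
    · have h1 : (((1 : G), g) : G × G) • (inB (g⁻¹ • x₀) : GluedPair X x₀) = none := by
        rw [hP.right, smul_inv_smul]; exact (inB_eq_none_iff x₀).mpr rfl
      have := smul_left_cancel _ (h.trans h1.symm)
      have hne : (inB (g⁻¹ • x₀) : GluedPair X x₀) ≠ some (Sum.inl y) := by
        unfold inB; split_ifs <;> simp
      exact absurd this.symm hne
    · exact ⟨y', rfl⟩
    · have h1 : (((1 : G), g) : G × G) • (inB (g⁻¹ • x) : GluedPair X x₀) = some (Sum.inr ⟨x, hx⟩) := by
        rw [hP.right, smul_inv_smul]; unfold inB; rw [dif_neg hx]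
      have := smul_left_cancel _ (h.trans h1.symm)
      have hne : (inB (g⁻¹ • x) : GluedPair X x₀) ≠ some (Sum.inl y) := by
        unfold inB; split_ifs <;> simp
      exact absurd this.symm hne
  -- compute `(g,g) • none` in the two orders
  have hcomm : ((g, (1 : G)) : G × G) * ((1, g) : G × G) = ((1, g) : G × G) * ((g, 1) : G × G) := by
    ext <;> simp
  have e1 : ((g, (1 : G)) : G × G) • (none : GluedPair X x₀) = some (Sum.inl ⟨g • x₀, hg⟩) := by
    have := hP.left g x₀
    rwa [show (inA x₀ : GluedPair X x₀) = none from (inA_eq_none_iff x₀).mpr rfl,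
      show (inA (g • x₀) : GluedPair X x₀) = some (Sum.inl ⟨g • x₀, hg⟩) by
        unfold inA; rw [dif_neg hg]] at this
  have e2 : (((1 : G), g) : G × G) • (none : GluedPair X x₀) = some (Sum.inr ⟨g • x₀, hg⟩) := by
    have := hP.right g x₀
    rwa [show (inB x₀ : GluedPair X x₀) = none from (inB_eq_none_iff x₀).mpr rfl,
      show (inB (g • x₀) : GluedPair X x₀) = some (Sum.inr ⟨g • x₀, hg⟩) by
        unfold inB; rw [dif_neg hg]] at this
  obtain ⟨y₁, hy₁⟩ := hA _ ⟨_, e2⟩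
  obtain ⟨y₂, hy₂⟩ := hB _ ⟨_, e1⟩
  have : some (Sum.inr y₁) = (some (Sum.inl y₂) : GluedPair X x₀) := by
    rw [← hy₁, ← hy₂, ← mul_smul, ← mul_smul, hcomm]
  simp at this

omit [DecidableEq X] in
/-- An action fixing `x₀` preserves `X ∖ {x₀}`. [cite: Mochizuki2012, Rmk 4.7.4 (iii) p.147] -/
theorem smul_ne_of_fix {G : Type v} [Group G] [MulAction G X] (hfix : ∀ g : G, g • x₀ = x₀)
    (g : G) {x : X} (hx : x ≠ x₀) : g • x ≠ x₀ := fun h => hx (by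
  have := congrArg (g⁻¹ • ·) h; simpa [hfix] using this)

/-- The candidate product action on `X_α ∐_{x₀} X_β` when `G` fixes `x₀`: `(g,h)` acts by `g` on the
spoke `α`, by `h` on the spoke `β`, and fixes the glue point ([IUTchII] Rmk 4.7.4 (iii) p. 147).
[cite: Mochizuki2012, Rmk 4.7.4 (iii) p.147] -/
def prodSMul {G : Type v} [Group G] [MulAction G X] (hfix : ∀ g : G, g • x₀ = x₀) (gh : G × G) :
    GluedPair X x₀ → GluedPair X x₀
  | none => none
  | some (Sum.inl x) => some (Sum.inl ⟨gh.1 • x.1, smul_ne_of_fix hfix gh.1 x.2⟩)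
  | some (Sum.inr x) => some (Sum.inr ⟨gh.2 • x.1, smul_ne_of_fix hfix gh.2 x.2⟩)

/-- **Remark 4.7.4 (ii)(b)/(iii), multiradial case, constructed:** if the action of `G` FIXES the
glue point (as `F_l^⋇ ↷ |F_l|` fixes `0`), the actions on the two spokes assemble to an action of
`G × G` on `X_α ∐_{x₀} X_β` — "the `F_l^⋇`-actions on distinct spokes commute with one another"
(p. 146), the arrow sets of (iii) are singletons, the environment is multiradial.
[cite: Mochizuki2012, Rmk 4.7.4 (iii) p.147] -/
@[reducible] def productAction {G : Type v} [Group G] [MulAction G X] (hfix : ∀ g : G, g • x₀ = x₀) :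
    MulAction (G × G) (GluedPair X x₀) where
  smul := prodSMul hfix
  one_smul z := by
    show prodSMul hfix 1 z = z
    rcases z with _ | ⟨⟨x, hx⟩ | ⟨x, hx⟩⟩
    · rfl
    · simp only [prodSMul, Prod.fst_one, one_smul]
    · simp only [prodSMul, Prod.snd_one, one_smul]
  mul_smul a b z := by
    show prodSMul hfix (a * b) z = prodSMul hfix a (prodSMul hfix b z)
    rcases z with _ | ⟨⟨x, hx⟩ | ⟨x, hx⟩⟩
    · rfl
    · simp only [prodSMul, Prod.fst_mul, mul_smul]
    · simp only [prodSMul, Prod.snd_mul, mul_smul]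

/-- The assembled action restricts to the given actions on both spokes ([IUTchII] Rmk 4.7.4 (iii)
p. 147: the arrow set "consist[s] of precisely one element"). [cite: Mochizuki2012, Rmk 4.7.4 (iii) p.147] -/
theorem productAction_isProductAction {G : Type v} [Group G] [MulAction G X]
    (hfix : ∀ g : G, g • x₀ = x₀) : IsProductAction G (productAction (x₀ := x₀) hfix) := by
  constructor
  · intro g x
    show prodSMul hfix (g, 1) (inA x) = inA (g • x)
    unfold inA
    by_cases hx : x = x₀
    · subst hx; rw [dif_pos rfl, dif_pos (hfix g)]; rfl
    · rw [dif_neg hx, dif_neg (smul_ne_of_fix hfix g hx)]; rfl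
  · intro g x
    show prodSMul hfix (1, g) (inB x) = inB (g • x)
    unfold inB
    by_cases hx : x = x₀
    · subst hx; rw [dif_pos rfl, dif_pos (hfix g)]; rfl
    · rw [dif_neg hx, dif_neg (smul_ne_of_fix hfix g hx)]; rfl

end GluedPair

/-! ### 4. The two symmetries of `F_l`: which one moves the zero label -/

/-- The translation `x ↦ x + 1` of `F_l` — an element of `F_l^⋊± = F_l ⋊ {±1}` ([IUTchI] Def 6.1)
— MOVES the zero label (`l ≥ 2`): the mathematical kernel of "the `F_l^⋊±`-symmetry involves the
zero label" ([IUTchII] Rmk 4.7.3 (ii) p. 144; Rmk 4.7.4 (ii)(a) p. 146). With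
`GluedPair.no_productAction_of_moves` this gives the uniradiality of Rmk 4.7.4 (iii).
[cite: Mochizuki2012, Rmk 4.7.4 (ii) p.146] -/
theorem zmod_translation_moves_zero (l : ℕ) [Fact (1 < l)] :
    Multiplicative.ofAdd (1 : ZMod l) • (0 : ZMod l) ≠ 0 := by
  rw [ofAdd_smul, vadd_eq_add, add_zero]
  exact one_ne_zero

/-- Multiplication by units of `F_l` — through which `F_l^⋇ = F_l^×/{±1}` acts on
`|F_l| = F_l/{±1}` ([IUTchI] §0) — FIXES the zero label: the kernel of "the `F_l^⋇`-symmetry …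
allows one to separate the zero label from the nonzero labels" ([IUTchII] Rmk 4.7.3 (iii) p. 145;
Rmk 4.7.4 (ii)(b) p. 146). With `GluedPair.productAction` this gives the multiradiality of
Rmk 4.7.4 (iii). [cite: Mochizuki2012, Rmk 4.7.4 (ii) p.146] -/
theorem units_smul_zero (l : ℕ) (u : (ZMod l)ˣ) : u • (0 : ZMod l) = 0 := by
  simp

/-- Uniradiality of the `F_l^⋊±`-model, assembled ([IUTchII] Rmk 4.7.4 (iii) p. 147): already for
the translation subgroup `F_l ⊆ F_l^⋊±` no product action on `(F_l)_α ∐_0 (F_l)_β` exists.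
[cite: Mochizuki2012, Rmk 4.7.4 (iii) p.147] -/
theorem additive_symmetry_uniradial (l : ℕ) [Fact (1 < l)]
    (act : MulAction (Multiplicative (ZMod l) × Multiplicative (ZMod l)) (GluedPair (ZMod l) 0)) :
    ¬ GluedPair.IsProductAction (Multiplicative (ZMod l)) act :=
  GluedPair.no_productAction_of_moves _ (zmod_translation_moves_zero l) act

/-- Multiradiality of the `F_l^⋇`-model, assembled ([IUTchII] Rmk 4.7.4 (iii) p. 147): the unit
actions on two spokes glued at `0` DO assemble to a product action.
[cite: Mochizuki2012, Rmk 4.7.4 (iii) p.147] -/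
theorem multiplicative_symmetry_multiradial (l : ℕ) :
    ∃ act : MulAction ((ZMod l)ˣ × (ZMod l)ˣ) (GluedPair (ZMod l) 0),
      GluedPair.IsProductAction (ZMod l)ˣ act :=
  ⟨_, GluedPair.productAction_isProductAction (units_smul_zero l)⟩

end Literature.IUT.HodgeArakelov
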